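import Literature.Probability.Percolation.ArmSeparationIntLand
import Literature.Probability.Percolation.ArmSeparationIntSurgery
import Literature.Probability.Percolation.ArmSeparationInwardExt
import Literature.Probability.Percolation.ArmSeparationSepInitWide
import Literature.Probability.Percolation.ArmSeparationSchemeFin
import HarnessLib

/-!
# Separation of the internal extremities of two landed arms (Stage II of the arm-separation theorem)

Topic: Probability / Percolation; family `crit-perc` (`P = P_{1/2} = triSitePercolation half`). A
brick of the discharge of `Literature.Probability.Percolation.Nolin2008_twoArm_separation`
(Nolin 2008, Thm. 11 [arXiv 0711.4948: Thm. 10], `j = 2`, `σ = BW`; `ArmSeparation.lean`):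
the internal half of the theorem,

`P̂(extTwoArm n N) ≤ C · P̂(sepTwoArm n N)`  for `n ≥ n₀`, `N ≥ 2n`,

i.e. two arms landed `N/64`-separated on `∂Λ_N` (`ArmSeparationExtArm.lean`) can also be required to
start `n/64`-separated on the right side of `∂Λ_n`, at constant cost. The proof is Nolin's
multi-scale summation for the internal extremities (Nolin 2008, §4.4, p. 13: "the same argument,
read inward"), on the ladder of inner radii `m_j = (n+1) 2^j - 1` (`m_{j+1} = 2 m_j + 1`,
`m_0 = n`): the finite-range scheme `le_mul_of_separationScheme_upto`
(`ArmSeparationSchemeFin.lean`) is fed with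

* the inward step `real_extTwoArm_le_step` (`ArmSeparationIntSurgery.lean`) and the bound
  `real_not_inGoodF_le` on failures around `∂Λ_m` (`ArmSeparationInnerFrames.lean`),
* the landing `exists_hland_const` of a rung (`ArmSeparationIntLand.lean`),
* the inward extension `exists_real_sepTwoArm_le_mul_inward` (`ArmSeparationInwardExt.lean`),
* the initial scale `exists_le_real_sepTwoArm_wide` (`ArmSeparationSepInitWide.lean`),

with the scheme constants `T, K, K_g` chosen ("first `T`, then `K`", Nolin 2008, §4.4, p. 12)
so that `ε C₀² ≤ 1/2` (`exists_scheme_constants`, also used by the external half):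
`exists_real_extTwoArm_le_mul_sepTwoArm`.

## References

* P. Nolin, *Near-critical percolation in two dimensions*, Electron. J. Probab. 13 (2008), §4.4,
  Thm. 11 and its proof, internal extremities [arXiv 0711.4948: Thm. 10, p. 13]. [Nolin2008]
* H. Kesten, *Scaling relations for 2D-percolation*, Comm. Math. Phys. 109 (1987), Lemma 2. [Kesten1987]
-/

noncomputable section

open Set MeasureTheory

namespace Literature.Probability.Percolation

open LatticeModels

/-! ### Constants -/

/-- `sepTwoArm ⊆ extTwoArm` (`2n ≤ N`). [folklore] -/
theorem sepTwoArm_subset_extTwoArm {n N : ℕ} (hnN : 2 * n ≤ N) : sepTwoArm n N ⊆ extTwoArm n N :=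
  inter_subset_inter (sepOpenArm_subset_extOpenArm hnN) (preimage_mono (sepOpenArm_subset_extOpenArm hnN))

/-- **The choice of the scheme constants** (Nolin 2008, §4.4, p. 12: "first `T`, then `K`"): for
`0 ≤ a, b < 1` and `C₀ ≥ 1` there are `T`, `K ≥ 1`, `K_g` with
`12 (a^{T+1} + T b^K + 2 b^{K_g}) C₀² ≤ 1/2`. [cite: Nolin2008, §4.4 (arXiv 0711.4948: proof of Thm. 10, p. 12)] -/
theorem exists_scheme_constants {a b C₀ : ℝ} (ha0 : 0 ≤ a) (ha1 : a < 1) (hb0 : 0 ≤ b) (hb1 : b < 1) (hC₀ : 1 ≤ C₀) :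
    ∃ T K Kg : ℕ, 1 ≤ K ∧ 12 * (a ^ (T + 1) + T * b ^ K + 2 * b ^ Kg) * C₀ ^ 2 ≤ 1 / 2 := by
  have hC2 : 0 < C₀ ^ 2 := by positivity
  set δ : ℝ := 1 / (72 * C₀ ^ 2) with hδ
  have hδ0 : 0 < δ := by positivity
  obtain ⟨T, hT⟩ := exists_pow_lt_of_lt_one hδ0 ha1
  have hδT : 0 < δ / (T + 1) := by positivity
  obtain ⟨K', hK'⟩ := exists_pow_lt_of_lt_one hδT hb1
  obtain ⟨Kg, hKg⟩ := exists_pow_lt_of_lt_one (half_pos hδ0) hb1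
  refine ⟨T, K' + 1, Kg, by omega, ?_⟩
  have h1 : a ^ (T + 1) ≤ δ := by
    calc a ^ (T + 1) ≤ a ^ T := pow_le_pow_of_le_one ha0 ha1.le (Nat.le_succ T)
      _ ≤ δ := hT.le
  have h2 : (T : ℝ) * b ^ (K' + 1) ≤ δ := by
    have hb' : b ^ (K' + 1) ≤ b ^ K' := pow_le_pow_of_le_one hb0 hb1.le (Nat.le_succ K')
    have hT0 : (0 : ℝ) ≤ T := Nat.cast_nonneg T
    have hT1 : (0 : ℝ) < T + 1 := by positivity
    calc (T : ℝ) * b ^ (K' + 1) ≤ (T + 1) * b ^ K' := by nlinarith [pow_nonneg hb0 K', pow_nonneg hb0 (K' + 1)]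
      _ ≤ (T + 1) * (δ / (T + 1)) := mul_le_mul_of_nonneg_left hK'.le hT1.le
      _ = δ := by field_simp
  have h3 : 2 * b ^ Kg ≤ δ := by linarith [hKg.le]
  calc 12 * (a ^ (T + 1) + T * b ^ (K' + 1) + 2 * b ^ Kg) * C₀ ^ 2 ≤ 12 * (δ + δ + δ) * C₀ ^ 2 := by
        gcongr
    _ = 1 / 2 := by rw [hδ]; field_simp; ring


/-! ### The ladder of inner radii -/

/-- The ladder of inner radii above the target radius `n`: `m_j = (n+1) 2^j - 1`, so that
`m_0 = n` and `m_{j+1} = 2 m_j + 1` (the rung of `ArmSeparationIntLand.lean` lands the arms of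
`extTwoArm m_{j+1} N` on `∂Λ_{m_j}`). [cite: Nolin2008, §4.4 (arXiv 0711.4948: proof of Thm. 10, p. 13, internal extremities)] -/
def inRad (n j : ℕ) : ℕ := (n + 1) * 2 ^ j - 1

/-- `m_0 = n`. [folklore] -/
theorem inRad_zero (n : ℕ) : inRad n 0 = n := by simp [inRad]

/-- `2 m_j + 2 = (n+1) 2^{j+1}`. [folklore] -/
theorem two_mul_inRad (n j : ℕ) : 2 * inRad n j + 2 = (n + 1) * 2 ^ (j + 1) := by
  unfold inRad
  have h1 : 1 ≤ (n + 1) * 2 ^ j := Nat.one_le_iff_ne_zero.2 (by positivity)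
  have h2 : (n + 1) * 2 ^ (j + 1) = 2 * ((n + 1) * 2 ^ j) := by rw [pow_succ]; ring
  omega

/-- `m_{j+1} = 2 m_j + 1`. [folklore] -/
theorem inRad_succ (n j : ℕ) : inRad n (j + 1) = 2 * inRad n j + 1 := by
  have h1 := two_mul_inRad n j
  have h2 : 1 ≤ (n + 1) * 2 ^ (j + 1) := Nat.one_le_iff_ne_zero.2 (by positivity)
  unfold inRad at h1 ⊢
  omega

/-- `n ≤ m_j`. [folklore] -/
theorem le_inRad (n j : ℕ) : n ≤ inRad n j := by
  induction j with
  | zero => rw [inRad_zero]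
  | succ j ih => rw [inRad_succ]; omega

/-- The ladder is increasing. [folklore] -/
theorem inRad_mono (n : ℕ) {j j' : ℕ} (h : j ≤ j') : inRad n j ≤ inRad n j' := by
  induction h with
  | refl => exact le_rfl
  | step _ ih => rw [inRad_succ]; omega

/-! ### Stage II -/

/-- **Stage II** (Nolin 2008, Thm. 11 with §4.4, internal extremities; Kesten 1987, Lemma 2):
there are `C > 0` and `n₀` such that for all `n ≥ n₀` and `N ≥ 2n`,
`P̂(extTwoArm n N) ≤ C · P̂(sepTwoArm n N)`: two arms landed separated on `∂Λ_N` can be required to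
start `n/64`-separated on the right side of `∂Λ_n` at constant cost. [cite: Nolin2008, Thm. 11, §4.4 (arXiv 0711.4948: Thm. 10, p. 13)] -/
theorem exists_real_extTwoArm_le_mul_sepTwoArm :
    ∃ C : ℝ, 0 < C ∧ ∃ n₀ : ℕ, ∀ n N : ℕ, n₀ ≤ n → 2 * n ≤ N →
      (triSitePercolation half).real (extTwoArm n N) ≤ C * (triSitePercolation half).real (sepTwoArm n N) := by
  -- the percolation constants
  obtain ⟨cF, hcF, hF⟩ := exists_pos_le_real_triFrameAt
  obtain ⟨c₂, hc₂, hrsw₂⟩ := tri_rsw_half_holds 24 (by norm_num)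
  obtain ⟨C₀, hC₀, hinw⟩ := exists_real_sepTwoArm_le_mul_inward
  obtain ⟨ci, hci, hinit⟩ := exists_le_real_sepTwoArm_wide
  have hcF1 : cF ≤ 1 := (hF 0 1 le_rfl).trans measureReal_le_one
  have hc₂1 : c₂ ≤ 1 := by
    have h := (hrsw₂ 1 (by norm_num)).1
    exact h.trans measureReal_le_one
  have hc₂5 : c₂ ^ 5 ≤ 1 := pow_le_one₀ hc₂.le hc₂1
  have hc₂5' : 0 < c₂ ^ 5 := by positivity
  -- the scheme constants
  obtain ⟨T, K, Kg, hK, hsmall⟩ := exists_scheme_constants (a := 1 - c₂ ^ 5) (b := 1 - cF ^ 2) (C₀ := C₀)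
    (by linarith) (by linarith) (by nlinarith) (by nlinarith) hC₀
  set ε₁ : ℝ := 12 * ((1 - c₂ ^ 5) ^ (T + 1) + T * (1 - cF ^ 2) ^ K + 2 * (1 - cF ^ 2) ^ Kg) with hε₁
  have hε0 : 0 ≤ ε₁ := by
    have h1 : 0 ≤ 1 - c₂ ^ 5 := by linarith
    have h2 : 0 ≤ 1 - cF ^ 2 := by nlinarith
    positivity
  -- the rung ratio `D = m / k₀`
  set D : ℕ := 256 * 32 ^ (K + Kg) with hD
  have h32K : 1 ≤ 32 ^ K := Nat.one_le_pow _ _ (by norm_num)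
  have h32Kg : 1 ≤ 32 ^ Kg := Nat.one_le_pow _ _ (by norm_num)
  have hDK : 256 * 32 ^ K ≤ D := by
    rw [hD, pow_add]; exact Nat.mul_le_mul_left _ (Nat.le_mul_of_pos_right _ h32Kg)
  have hD1 : 1 ≤ D := le_trans (by omega) hDK
  obtain ⟨C₁, hC₁, hland⟩ := exists_hland_const D K hK hDK
  refine ⟨2 * C₁ + 1 / ci, by positivity, 64 * D + 1100, fun n N hn hN => ?_⟩
  have hS0 : 0 ≤ (triSitePercolation half).real (sepTwoArm n N) := measureReal_nonneg
  have hCc : 1 / ci ≤ 2 * C₁ + 1 / ci := by linarith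
  by_cases h10 : N ≤ 10 * n
  · -- few scales: the initial estimate directly
    have h1 : ci ≤ (triSitePercolation half).real (sepTwoArm n N) := hinit n N (by omega) hN h10
    calc (triSitePercolation half).real (extTwoArm n N) ≤ 1 := measureReal_le_one
      _ ≤ 1 / ci * (triSitePercolation half).real (sepTwoArm n N) := by
          rw [one_div_mul_eq_div, le_div_iff₀ hci, one_mul]; exact h1
      _ ≤ _ := mul_le_mul_of_nonneg_right hCc hS0
  push Not at h10
  -- the number of rungs: `J + 1 = ⌊log₂ ((N+2)/(n+1))⌋`
  have hn0 : 0 < n + 1 := Nat.succ_pos n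
  set q := (N + 2) / (n + 1) with hq
  have hq8 : 8 ≤ q := (Nat.le_div_iff_mul_le hn0).2 (by omega)
  obtain ⟨e, he1, he2⟩ : ∃ e, 2 ^ e ≤ q ∧ q < 2 ^ (e + 1) :=
    ⟨Nat.log 2 q, Nat.pow_log_le_self 2 (by omega), Nat.lt_pow_succ_log_self one_lt_two _⟩
  have he3 : 3 ≤ e := by
    by_contra h
    push Not at h
    have : 2 ^ (e + 1) ≤ 8 := by
      calc 2 ^ (e + 1) ≤ 2 ^ 3 := Nat.pow_le_pow_right (by norm_num) (by omega)
        _ = 8 := by norm_num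
    omega
  obtain ⟨J, rfl⟩ : ∃ J, e = J + 1 := ⟨e - 1, by omega⟩
  obtain ⟨J', hJ'⟩ : ∃ J', J = J' + 1 := ⟨J - 1, by omega⟩
  have hX1 : (n + 1) * 2 ^ (J + 1) ≤ N + 2 := by
    have := (Nat.le_div_iff_mul_le hn0).1 he1; rw [Nat.mul_comm]; exact this
  have hX2 : N + 2 < (n + 1) * 2 ^ (J + 1 + 1) := by
    have := (Nat.div_lt_iff_lt_mul hn0).1 he2; rw [Nat.mul_comm]; exact this
  -- the extreme rungs
  have h2mJ : 2 * inRad n J ≤ N := by have := two_mul_inRad n J; omega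
  have hinitJ : N ≤ 10 * inRad n J' := by
    have h1 := two_mul_inRad n J'
    rw [← hJ'] at h1
    have h2 : (n + 1) * 2 ^ (J + 1 + 1) = 4 * ((n + 1) * 2 ^ J) := by rw [pow_succ, pow_succ]; ring
    have h3 := le_inRad n J'
    omega
  have hrad : ∀ i, i + 1 ≤ J → inRad n (J - i) = 2 * inRad n (J - (i + 1)) + 1 := fun i hi => by
    rw [show J - i = J - (i + 1) + 1 by omega, inRad_succ]
  have hradJ : ∀ j, j ≤ J → 2 * inRad n j ≤ N := fun j hj => by have := inRad_mono n hj; omega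
  have hk₀ : ∀ j, 64 ≤ inRad n j / D := fun j =>
    (Nat.le_div_iff_mul_le (by omega)).2 (by have := le_inRad n j; omega)
  have hu : 1 ≤ 32 ^ K * 32 ^ Kg := Nat.one_le_iff_ne_zero.2 (by positivity)
  -- the scheme, read inward: index `i` ↦ radius `m_{J-i}`
  have key := le_mul_of_separationScheme_upto
    (f := fun i => (triSitePercolation half).real (extTwoArm (inRad n (J - i)) N))
    (g := fun i => (triSitePercolation half).real
      (IntTinyExt (inRad n (J - i)) N (inRad n (J - i) / D) K (8 * trapScale (inRad n (J - i) / D) K)))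
    (h := fun i => (triSitePercolation half).real (sepTwoArm (inRad n (J - i)) N))
    (k := 0) (L := J) (ε := ε₁) (C₀ := C₀) (C₁ := C₁) (c := ci) hε0 hC₀ hC₁ hci hsmall
    (fun _ => measureReal_le_one) (fun _ => measureReal_nonneg) (by omega)
    (fun i _ hiJ => ?_) (fun i _ hiJ => ?_) (fun i hi1 hiJ => ?_) (fun i hi1 hiJ => ?_) ?_ J (by omega) le_rfl
  · simpa only [Nat.sub_self, inRad_zero] using key
  · -- monotonicity in the inner radius
    show (triSitePercolation half).real (extTwoArm (inRad n (J - (i + 1))) N) ≤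
        (triSitePercolation half).real (extTwoArm (inRad n (J - i)) N)
    refine measureReal_mono (extTwoArm_mono (inRad_mono n (by omega)) ?_)
    have := hradJ (J - i) (by omega); omega
  · -- the inward step at the rung `m = m_{J-i-1}`, `2m+1 = m_{J-i}`
    set m := inRad n (J - (i + 1)) with hm
    show (triSitePercolation half).real (extTwoArm m N) ≤
        (triSitePercolation half).real (IntTinyExt m N (m / D) K (8 * trapScale (m / D) K)) +
          ε₁ * (triSitePercolation half).real (extTwoArm (inRad n (J - i)) N)
    rw [hrad i hiJ]
    have hmn : n ≤ m := le_inRad n _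
    have hm2 : 2 * (2 * m + 1) ≤ N := by rw [← hrad i hiJ]; exact hradJ _ (by omega)
    set k₀ := m / D with hk₀'
    have hk64 : 64 ≤ k₀ := hk₀ _
    have hkD : D * k₀ ≤ m := Nat.mul_div_le m D
    have hts : ∀ j < K, 32 * trapScale k₀ j ≤ trapScale k₀ K := fun j hj => by
      calc 32 * trapScale k₀ j = trapScale k₀ (j + 1) := (trapScale_succ _ _).symm
        _ ≤ trapScale k₀ K := trapScale_mono _ hj
    have hμ : trapScale k₀ K = k₀ * 32 ^ K := rfl
    have hx0 : 64 ≤ k₀ * 32 ^ K := by nlinarith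
    have hμ1 : 1 ≤ trapScale k₀ K := by rw [hμ]; omega
    have hDk : 256 * (k₀ * 32 ^ K) * 32 ^ Kg = D * k₀ := by rw [hD, pow_add]; ring
    have hμm : 2 * trapScale k₀ K < m := by
      -- `2 k₀ 32^K < 256 k₀ 32^K ≤ 256 k₀ 32^(K+Kg) = D k₀ ≤ m`
      have h1 : 256 * (k₀ * 32 ^ K) ≤ 256 * (k₀ * 32 ^ K) * 32 ^ Kg := Nat.le_mul_of_pos_right _ (by positivity)
      rw [hμ]; omega
    have hguard : ∀ i < Kg, 32 * trapScale (8 * trapScale k₀ K) i ≤ m := fun i hi => by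
      -- `32 · 8 k₀ 32^K · 32^i ≤ 8 k₀ 32^(K+Kg) ≤ D k₀ ≤ m`
      have h1 : 32 * 32 ^ i ≤ 32 ^ Kg := by
        rw [← pow_succ']; exact Nat.pow_le_pow_right (by norm_num) hi
      unfold trapScale
      calc 32 * (8 * (k₀ * 32 ^ K) * 32 ^ i) = 8 * (k₀ * 32 ^ K) * (32 * 32 ^ i) := by ring
        _ ≤ 8 * (k₀ * 32 ^ K) * 32 ^ Kg := Nat.mul_le_mul_left _ h1
        _ ≤ 256 * (k₀ * 32 ^ K) * 32 ^ Kg := Nat.mul_le_mul_right _ (by omega)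
        _ ≤ m := by rw [hDk]; exact hkD
    have hg1 : ∀ i, 1 ≤ trapScale (8 * trapScale k₀ K) i := fun i => one_le_trapScale (by omega) i
    have step := real_extTwoArm_le_step (m := m) (N := N) (T := T) (k₀ := k₀) (K := K) (R₀ := 8 * trapScale k₀ K) (Kg := Kg)
      (by omega) hm2 (by omega) (fun j hj => by have := hts j hj; omega) hguard
      (fun i hi => by have := hguard i hi; have := hg1 i; omega)
    have bound := real_not_inGoodF_le hcF hF (fun q hq => (hrsw₂ q hq).1) hc₂.le (m := m) (T := T) (k₀ := k₀) (K := K)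
      (R₀ := 8 * trapScale k₀ K) (Kg := Kg) (by omega) (by omega) (by omega)
      (fun j hj => by have := hts j hj; omega)
    have hE0 : 0 ≤ (triSitePercolation half).real (extTwoArm (2 * m + 1) N) := measureReal_nonneg
    calc (triSitePercolation half).real (extTwoArm m N)
        ≤ (triSitePercolation half).real (IntTinyExt m N k₀ K (8 * trapScale k₀ K)) +
            (triSitePercolation half).real {ω | ¬ InGoodF m T k₀ K (8 * trapScale k₀ K) Kg ω} *
              (triSitePercolation half).real (extTwoArm (2 * m + 1) N) := step
      _ ≤ _ := add_le_add le_rfl (mul_le_mul_of_nonneg_right bound hE0)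
  · -- the landing of the rung `m_{J-i}` onto `∂Λ_{m_{J-i-1}}`
    show (triSitePercolation half).real
        (IntTinyExt (inRad n (J - i)) N (inRad n (J - i) / D) K (8 * trapScale (inRad n (J - i) / D) K)) ≤
          C₁ * (triSitePercolation half).real (sepTwoArm (inRad n (J - (i + 1))) N)
    have h := hland (inRad n (J - i)) N (by have := le_inRad n (J - i); omega) (by rw [hrad i hiJ]; omega)
      (by have := le_inRad n (J - i); omega) (hradJ _ (by omega))
    have e2 : (inRad n (J - i) - 1) / 2 = inRad n (J - (i + 1)) := by rw [hrad i hiJ]; omega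
    rw [e2] at h
    exact h
  · -- the inward extension
    show (triSitePercolation half).real (sepTwoArm (inRad n (J - i)) N) ≤
        C₀ * (triSitePercolation half).real (sepTwoArm (inRad n (J - (i + 1))) N)
    have h1 := le_inRad n (J - (i + 1))
    exact hinw (inRad n (J - i)) (inRad n (J - (i + 1))) N (by omega) (by rw [hrad i hiJ]) (by rw [hrad i hiJ]; omega)
      (hradJ _ (by omega))
  · -- the initial scale `m_{J-1}`: `2 m_{J-1} ≤ N ≤ 10 m_{J-1}`
    show ci ≤ (triSitePercolation half).real (sepTwoArm (inRad n (J - (0 + 1))) N)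
    rw [show J - (0 + 1) = J' by omega]
    exact hinit (inRad n J') N (by have := le_inRad n J'; omega) (hradJ _ (by omega)) hinitJ

end Literature.Probability.Percolation
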